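import Summits.ResolutionOfSingularities.ResolutionOfSingularities.Theorems.WallTowers
import HarnessLib

/-!
# WallCutCells — decomp-res node «WallCut» (lens-4 g30, critic rows 176/176a CLEARED DECIDED +1), tree file 7/8 of the node

Content VERBATIM from the decomp-res lens-4 g30 node `HOME/decomp-res-lens-4/g30/WallCut.lean` (pin c43ccc48;
imports the landed tree only, carries nothing);
HOME = run/shared/lean/pub/decomp-res; critic rows 176/176a CLEARED DECIDED +1; landing orders INBOX :819 —
provenance, critic text and the lens header in full in the first file of the
node, `WallAlgebra`.  Namespace `…Theorems.HugValuationCut`; `--supports stmt-ResolutionOfSingularities-28338`.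

## This file

§85 (ENTRANCE CERTIFICATES) kernel-checked chart identities of the two finite profiles quoted in the cells'
docstrings (`section Entrances`); §86 (NEW) THE CUT of the g29 located residual by WALL DEATH — `section WallCells`
minus the four corollaries GIVEN 31571 (→ `MaxContactCutWallCut`): the decided cell
`WildWalledFreshJumpShallowCompanionKangarooTowersTerminate n` / **`NoWildWalledTowers`** (DECIDED · PROVED IN
KERNEL · EMPTY for every `n`, every field: `noWildWalledTowers_holds` ⟸ `wildWalledFreshJumpShallow_holds` ⟸
`noTowerWild_walled_holds`), THE LOCATED RESIDUAL **`NoWildWallFreeFreshJumpShallowCompanionKangarooTowers`** (`∀ n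
≥ 1, WildWallFreeFreshJumpShallowCompanionKangarooTowersTerminate n`; this module is its cone-free home), the EXACT
hypothesis-free re-locations `noWildFreshJumpShallowCompanionKangarooTowers_iff_walled_and_wallFree`,
`noWildFreshJumpShallowCompanionKangarooTowers_iff_g30` (g29 TARGET ⟺ RESIDUAL),
`noWildFreeJumpShallowCompanionKangarooTowers_iff_g30` (g28), `noWildShallowCompanionKangarooTowers_iff_g30` (g27),
`noWildCompanionKangarooTowers_iff_g30` (g26), and the up-links `…_of_g29` / `…_of_aside`.  Imports `WallTowers` (⊇
`HistoryCutCells`).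

[WRITER NOTE (decomp-res writer g11): file split only (tree files ≤ 400 lines); namespace, universes, sections,
section variables and every declaration
exactly as in the lens (the node's global dupNamespace-linter line is dropped — the library sets it; the `open
…Theses` line lives only in the Theses-cone file;
`set_option maxHeartbeats … in` prefixes of single declarations are kept VERBATIM).  ONE deletion (gate dedup rule,
critic :835 watch-list): the node's private copy of
isUnit_add_of_mem_maximalIdeal` is NOT re-landed — it is LITERALLY the landed
`Literature.AlgebraicGeometry.Resolution.isUnit_add_of_mem_maximalIdeal` (`WeightedInitialTerms`,
imported; the namespace is opened as in the lens), which the transport proofs now cite by the same short name.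
SECOND deletion (gate dedup bounce p810318):
the node's `range_triple` is NOT re-landed — it is LITERALLY the landed
`…Cruxes.HypersurfaceCentreConstruction.LocalEngine.Iota3.range_vec₃`
(`Theorems/WeightedInvariantIota3FlagTools`, imported from `WallAlgebra2` on; aliased by an explicit `open …
(range_vec₃)`), cited by name at its two uses.]

(Sources: Hauser2010Kangaroo (arXiv:0811.4151, Kangaroo Theorem condition (3)); HauserPerlega2019 §2; Hauser2024
PRIMS 60; Moh1987; Perlega2023; Matsumura1987 Thms. 14.2–14.3, 19.x; ZariskiSamuel1960 VIII §11; StacksProject Tags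
0804, 0BIQ, 00NQ, 0AGS; DeJong1996 2.4; CossartPiltant2008 §2; Giraud1975.)
-/

noncomputable section

open CategoryTheory AlgebraicGeometry IsLocalRing
open Literature.AlgebraicGeometry.Resolution
open Summit.ResolutionOfSingularities.ResolutionOfSingularities.Theorems
open WeakOrderReduction ForcedTowerClasses DivergentTowerClasses MonomialTowerClasses
open HugDimensionClasses HugDimensionKernels SurfaceShadowClasses SurfaceShadowKernels
open NearPointCut (SingularClass)
open scoped BigOperators
open Summit.ResolutionOfSingularities.ResolutionOfSingularities.Cruxes.HypersurfaceCentreConstruction.LocalEngine.Iota3 (range_vec₃)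

namespace Summit.ResolutionOfSingularities.ResolutionOfSingularities.Theorems.HugValuationCut

section Entrances

variable {R : Type*} [CommRing R]

/-! ## §85 (g30 · ENTRANCE CERTIFICATES) kernel-checked chart identities of the two finite profiles quoted in the cells'
docstrings (the blow-up charts are the standard monomial substitutions; the identities hold over every commutative ring, the one
re-centring uses characteristic 2). -/

/-- DECIDED-SIDE ENTRANCE, census chain «2:E8iso:y2+x3+u5», step 0 (`u`-chart): `f₀(xu, yu, u) = u²·f₁`. [folklore] -/
theorem entrance_E8iso_chart₀ (x y u : R) :
    (y * u) ^ 2 + (x * u) ^ 3 + u ^ 5 = u ^ 2 * (y ^ 2 + x ^ 3 * u + u ^ 3) := by ring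

/-- step 1 (`x`-chart): `f₁(x, yx, ux) = x²·f₂`. [folklore] -/
theorem entrance_E8iso_chart₁ (x y u : R) :
    (y * x) ^ 2 + x ^ 3 * (u * x) + (u * x) ^ 3 = x ^ 2 * (y ^ 2 + x ^ 2 * u + x * u ^ 3) := by ring

/-- step 2 (`u`-chart): `f₂(xu, yu, u) = u²·f₃`. [folklore] -/
theorem entrance_E8iso_chart₂ (x y u : R) :
    (y * u) ^ 2 + (x * u) ^ 2 * u + (x * u) * u ^ 3 = u ^ 2 * (y ^ 2 + x ^ 2 * u + x * u ^ 2) := by ring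

/-- step 3 (`u`-chart): `f₃(xu, yu, u) = u²·f₄`. [folklore] -/
theorem entrance_E8iso_chart₃ (x y u : R) :
    (y * u) ^ 2 + (x * u) ^ 2 * u + (x * u) * u ^ 2 = u ^ 2 * (y ^ 2 + x ^ 2 * u + x * u) := by ring

/-- THE TWO-WALL PRESENTATIONS READ OFF: `f₂ = y² + x·u·(1·u² + 1·x)` (kept wall `x = E₂`, other wall `u = E₁'`, WALL EXPONENT
`e = 2`), `f₃ = y² + x·u·(1·u¹ + 1·x)` (`e = 1`: the clock ticked), `f₄ = y² + x·u·(x + 1)` (cofactor a UNIT at the origin: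
initial form `y² + xu`, not a square — the EXIT LEMMA; the census exit «CONTACT»). [folklore] -/
theorem entrance_E8iso_twoWall (x y u : R) :
    y ^ 2 + x ^ 2 * u + x * u ^ 3 - 1 * y ^ 2 = x * u * (1 * u ^ 2 + 1 * x + 0 * y) ∧
      y ^ 2 + x ^ 2 * u + x * u ^ 2 - 1 * y ^ 2 = x * u * (1 * u ^ 1 + 1 * x + 0 * y) ∧
        y ^ 2 + x ^ 2 * u + x * u = y ^ 2 + x * u * (x + 1) := by
  refine ⟨by ring, by ring, by ring⟩

/-- step 3, THE FREE EXIT (`x`-chart of the blow-up of the `e = 1` stage `f₃ = y² + x²u + xu²`; `t = u/x` the free coordinate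
of `E₄`): `f₃(x, yx, tx) = x²·(y² + x·t·(1 + t))` — off the kept wall (`x` is now exceptional), on `E₃' = (t)` at `t = 0`
(lateral: `in₂ = y² + xt`, not a square), and at the RATIONAL point `t ≡ 1` the cofactor `1 + t` vanishes: `(x, 1 + t, y)` is a
regular system and `in₂ = y² + x·(1 + t)·unit` is not a `2`-power form — `twoWall_point_fatal`; at `t ∉ {0, 1}` the
order is 1. [folklore] -/
theorem entrance_E8iso_chart₄_free (x y t : R) :
    (y * x) ^ 2 + x ^ 2 * (t * x) + x * (t * x) ^ 2 = x ^ 2 * (y ^ 2 + x * t * (1 + t)) := by ring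

/-- DECIDED-SIDE ENTRANCE (E2) (hand chain `z² + x³ + u⁴ + u⁵`, char 2), step 0 (`u`-chart): `f₀(xu, zu, u) = u²·f₁` with
`f₁ = z² + u² + x³u + u³`. [folklore] -/
theorem entrance_hand_chart₀ (x z u : R) :
    (z * u) ^ 2 + (x * u) ^ 3 + u ^ 4 + u ^ 5 = u ^ 2 * (z ^ 2 + u ^ 2 + x ^ 3 * u + u ^ 3) := by ring

/-- THE FRESH JUMP at the `u`-chart origin (characteristic 2): `f₁ = (z + u)² + u·(x³ + u²)` — the initial form `z²
+ u² = (z + u)²`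
is the square of the CALIBRATED germ `z + u`, not of the transported germ `z` (weak contact along `z` is lost by the letter
`u²` of the NEW exceptional divisor `E₁ = (u)`, and the point lies on `E₁` only). [folklore] -/
theorem entrance_hand_jump [CharP R 2] (x z u : R) :
    z ^ 2 + u ^ 2 + x ^ 3 * u + u ^ 3 = (z + u) ^ 2 + u * (x ^ 3 + u ^ 2) := by
  have h2 : (2 : R) = 0 := by simpa using CharP.cast_eq_zero R 2
  have e : (z + u) ^ 2 = z ^ 2 + u ^ 2 + 2 * (z * u) := by ring
  rw [e, h2]
  ring

/-- step 1 (`x`-chart at the jump point, in the calibrated letter `z̃ = z + u`): `f̃₁(x, z̃x, ux) = x²·(z̃² + x²u + xu³)` — the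
transform IS the two-wall stage `f₂` of the chain (E1) (`e = 2`): by WALL DEATH the tower has at most one further marked point —
a fresh jump followed by a wall is fatal. [folklore] -/
theorem entrance_hand_chart₁ (x z u : R) :
    (z * x) ^ 2 + (u * x) * (x ^ 3 + (u * x) ^ 2) = x ^ 2 * (z ^ 2 + x ^ 2 * u + x * u ^ 3) := by ring

end Entrances

section WallCells

/-! ## §86 (g30 · NEW) THE CUT of the g29 located residual by WALL DEATH — cells and EXACT re-locations BY NAME -/

/-- **CELL (g29 residual ∧ weight 2 ∧ WALLED)** — DECIDED: EMPTY by WALL DEATH (`no_walledTower`; `p ∣ 2` forces `p = 2`).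
ENTRANCES (the configuration of the law OCCURS in the class, the wall exponent is COMPUTED and SEEN TO DROP to `1`, after which
the profile has no class successor): (E1) census HOME/census/it/history T-history f608fd95 row «2:E8iso:y2+x3+u5:FOFF0:1», word
`u x u u`, char 2, weight 2, ring dimension 3: `y² + x³ + u⁵ →(u) y² + x³u + u³ →(x) y² + x·u·(x + u²)` — TWO-WALL
stage, kept wall
`W = E₂ = (x)`, other wall `V = E₁' = (u)`, germ `z = y`, cofactor `g = 1·u² + 1·x + 0·y`: WALL EXPONENT `e = 2` —
`→(u) y² + x·u·(x +
u)`: on `W' = (x)`, two-wall with `e = 1` (THE CLOCK TICKED) — and NO class successor: on `W'' = (x)` the cofactor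
`x + 1` is a unit
(`in₂ = y² + xu` is not a square — `twoWall_point_exit`), off `W''` the point is on `V'' = E₃'` (lateral:
`twoWall_point_exit`) or
FREE, and then it is the RATIONAL point `t := u/x ≡ 1` of `E₄` where the cofactor `1 + t` vanishes: `(x, 1 + t, y)` is a regular
system and `f = y² + x·t·(1 + t)`, `in₂ = y² + x·(1+t)·unit`, is NOT a `2`-power form (`twoWall_point_fatal`) — the
census records
all 42 char-2 `l = 1` windows of T-history (i) exiting by CONTACT at exactly this step, 0 by JUMP; (E2) the hand
chain `z² + x³ + u⁴ + u⁵ →(u) (z+u)² + u·(x³ + u²)` — a FRESH kangaroo jump (contact along `z` lost by the letter `u²` of `E₁`,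
regained along `z + u`; one wall only) — `→(x) z₁² + x·u·(x + u²)`: TWO-WALL, `e = 2`, hence DEAD two stages later by the law: a
fresh jump does not protect a tower once it is walled; g28's decided chain `z² + u³ + v⁵ → … → z''² + u'v''(u' +
v''²)` (`e = 2`) is
the same clock. -/
def WildWalledFreshJumpShallowCompanionKangarooTowersTerminate (n : ℕ) : Prop :=
  NoTowerWild n fun T =>
    ((((((SingularClass T ∧ Nonempty (MarkedShadow T n)) ∧ PPowerTower n T) ∧ ¬ EventuallyJumpFree n T) ∧
      ¬ EventuallyCompanionJumpFree n T) ∧ ¬ DeepTower n T) ∧ ¬ (n.Prime ∧ OldComponentJumpTower n T)) ∧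
      (n = 2 ∧ WalledTower T)

/-- **CELL (g29 residual ∧ ¬(weight 2 ∧ walled)) · THE LOCATED RESIDUAL after g30** — UNDECIDED · IDEA-NEEDED: wild, off-locus
singular class, `p`-power form at every marked point, kangaroo-recurrent, companion-recurrent, shallow, fresh-jumping at prime
weight, and — at weight 2 — WALL-FREE: NO stage is a two-wall stage of exponent `e` followed by `e` stages of ring
dimension 3; in
words, over a threefold the tower NEVER enters the two-wall configuration (every satellite point it visits has a
DEGENERATE cofactor:
`u` or `a` a non-unit in `g = u·v^e + a·w + b·z`).  ENTRANCES: (R1) `p ≥ 3`: the whole g29 residual is untouched by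
the weight-2 law —
NODE-g29's char-5 chain `z⁵ + x⁴(y³ − x²)² + x⁷y²` (four fresh jumps, shade 2 throughout) carries every positive
letter; (R2) `p = 2`:
NO wall-free fresh-jumping profile is known — both char-2 hand chains and all 42 census windows are walled within
two steps of each
jump and die (cell above); the ENTRY LAW «at weight 2 in ring dimension 3 every fresh jump is followed, within one
point blow-up, by a
two-wall stage» would EMPTY this cell at `p = 2` and is the next kernel target (NEXT-g31 §1). -/
def WildWallFreeFreshJumpShallowCompanionKangarooTowersTerminate (n : ℕ) : Prop :=
  NoTowerWild n fun T =>
    ((((((SingularClass T ∧ Nonempty (MarkedShadow T n)) ∧ PPowerTower n T) ∧ ¬ EventuallyJumpFree n T) ∧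
      ¬ EventuallyCompanionJumpFree n T) ∧ ¬ DeepTower n T) ∧ ¬ (n.Prime ∧ OldComponentJumpTower n T)) ∧
      ¬ (n = 2 ∧ WalledTower T)

/-- **KERNEL (PROVED, every class, every `n`): THE WEIGHT-2 WALLED COLUMN OF EVERY WILD `p`-POWER CLASS IS EMPTY** — the general
form of the cut, applicable verbatim to every other lens's `p`-power tower residual. [folklore] -/
theorem noTowerWild_walled_holds (n : ℕ) (P : ForcedTower → Prop) (hPP : ∀ T, P T → PPowerTower n T) :
    NoTowerWild n fun T => P T ∧ (n = 2 ∧ WalledTower T) := by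
  intro p hp hpn k _ _ T g hB hD _ hT
  obtain ⟨hPT, hn, hwall⟩ := hT
  subst hn
  have hp2 : p = 2 := (Nat.prime_dvd_prime_iff_eq hp Nat.prime_two).mp hpn
  subst hp2
  exact no_walledTower T g hB hD (hPP T hPT) hwall

/-- **KERNEL (pure logic): every class splits EXACTLY by `n = 2 ∧ WalledTower`.** [folklore] -/
theorem noTowerWild_split_walled {n : ℕ} (P : ForcedTower → Prop) :
    NoTowerWild n P ↔ NoTowerWild n (fun T => P T ∧ (n = 2 ∧ WalledTower T)) ∧
      NoTowerWild n (fun T => P T ∧ ¬ (n = 2 ∧ WalledTower T)) :=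
  noTowerWild_split _ _

/-- **DECIDED (KERNEL, PROVED, every `n`, every field): THE WALLED CELL IS EMPTY.** [folklore] -/
theorem wildWalledFreshJumpShallow_holds (n : ℕ) : WildWalledFreshJumpShallowCompanionKangarooTowersTerminate n :=
  noTowerWild_walled_holds n _ fun _ hT => hT.1.1.1.1.2

/-- **EXACT (pure logic): the g29 located residual = the walled bed ∧ the wall-free residual.** [folklore] -/
theorem wildFreshJumpShallow_split_g30 (n : ℕ) :
    WildFreshJumpShallowCompanionKangarooTowersTerminate n ↔
      WildWalledFreshJumpShallowCompanionKangarooTowersTerminate n ∧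
        WildWallFreeFreshJumpShallowCompanionKangarooTowersTerminate n :=
  noTowerWild_split _ _

/-- **EXACT RE-LOCATION, HYPOTHESIS-FREE (KERNEL, PROVED): the g29 located residual ⟺ THE WALL-FREE RESIDUAL.** [folklore] -/
theorem wildFreshJumpShallow_iff_g30 (n : ℕ) :
    WildFreshJumpShallowCompanionKangarooTowersTerminate n ↔ WildWallFreeFreshJumpShallowCompanionKangarooTowersTerminate n :=
  ⟨fun h => ((wildFreshJumpShallow_split_g30 n).mp h).2,
    fun h => (wildFreshJumpShallow_split_g30 n).mpr ⟨wildWalledFreshJumpShallow_holds n, h⟩⟩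

/-- the g28 located residual ⟺ the wall-free residual (hypothesis-free). [folklore] -/
theorem wildFreeJumpShallow_iff_g30 (n : ℕ) :
    WildFreeJumpShallowCompanionKangarooTowersTerminate n ↔ WildWallFreeFreshJumpShallowCompanionKangarooTowersTerminate n :=
  (wildFreeJumpShallow_iff_g29 n).trans (wildFreshJumpShallow_iff_g30 n)

/-- BY NAME: **no wild WALLED tower** (DECIDED: PROVED). -/
def NoWildWalledTowers : Prop :=
  ∀ n : ℕ, 1 ≤ n → WildWalledFreshJumpShallowCompanionKangarooTowersTerminate n

/-- BY NAME: **no wild WALL-FREE fresh-jumping shallow companion-recurrent tower** — THE LOCATED RESIDUAL of the aside chain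
`NoWildContactFreeOffLocusTowers ⊇ … ⊇ NoWildFreeJumpShallowCompanionKangarooTowers ⊇
NoWildFreshJumpShallowCompanionKangarooTowers ⊇ ·`
after g30. -/
def NoWildWallFreeFreshJumpShallowCompanionKangarooTowers : Prop :=
  ∀ n : ℕ, 1 ≤ n → WildWallFreeFreshJumpShallowCompanionKangarooTowersTerminate n

/-- **DECIDED BY NAME (KERNEL, PROVED).** [folklore] -/
theorem noWildWalledTowers_holds : NoWildWalledTowers := fun n _ => wildWalledFreshJumpShallow_holds n

/-- **EXACT RE-LOCATION BY NAME, HYPOTHESIS-FREE: THE TARGET (g29 residual) ⟺ THE WALL-FREE RESIDUAL.** [folklore] -/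
theorem noWildFreshJumpShallowCompanionKangarooTowers_iff_g30 :
    NoWildFreshJumpShallowCompanionKangarooTowers ↔ NoWildWallFreeFreshJumpShallowCompanionKangarooTowers :=
  ⟨fun h n hn => (wildFreshJumpShallow_iff_g30 n).mp (h n hn),
    fun h n hn => (wildFreshJumpShallow_iff_g30 n).mpr (h n hn)⟩

/-- **EXACT BY NAME as a conjunction (walled ∧ wall-free), hypothesis-free.** [folklore] -/
theorem noWildFreshJumpShallowCompanionKangarooTowers_iff_walled_and_wallFree :
    NoWildFreshJumpShallowCompanionKangarooTowers ↔
      NoWildWalledTowers ∧ NoWildWallFreeFreshJumpShallowCompanionKangarooTowers :=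
  ⟨fun h => ⟨noWildWalledTowers_holds, noWildFreshJumpShallowCompanionKangarooTowers_iff_g30.mp h⟩,
    fun h => noWildFreshJumpShallowCompanionKangarooTowers_iff_g30.mpr h.2⟩

/-- **EXACT RE-LOCATION BY NAME, HYPOTHESIS-FREE: the g28 residual ⟺ the wall-free residual.** [folklore] -/
theorem noWildFreeJumpShallowCompanionKangarooTowers_iff_g30 :
    NoWildFreeJumpShallowCompanionKangarooTowers ↔ NoWildWallFreeFreshJumpShallowCompanionKangarooTowers :=
  noWildFreeJumpShallowCompanionKangarooTowers_iff_g29.trans noWildFreshJumpShallowCompanionKangarooTowers_iff_g30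

/-- **EXACT RE-LOCATION BY NAME, HYPOTHESIS-FREE: the g27 residual ⟺ the wall-free residual.** [folklore] -/
theorem noWildShallowCompanionKangarooTowers_iff_g30 :
    NoWildShallowCompanionKangarooTowers ↔ NoWildWallFreeFreshJumpShallowCompanionKangarooTowers :=
  noWildShallowCompanionKangarooTowers_iff_g29.trans noWildFreshJumpShallowCompanionKangarooTowers_iff_g30

/-- **EXACT RE-LOCATION BY NAME, HYPOTHESIS-FREE: the g26 residual ⟺ the wall-free residual.** [folklore] -/
theorem noWildCompanionKangarooTowers_iff_g30 :
    NoWildCompanionKangarooTowers ↔ NoWildWallFreeFreshJumpShallowCompanionKangarooTowers :=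
  noWildCompanionKangarooTowers_iff_g29.trans noWildFreshJumpShallowCompanionKangarooTowers_iff_g30

/-- up-link (hypothesis-free): the g30 residual ⟸ the g29 residual (THE TARGET). [folklore] -/
theorem noWildWallFreeFreshJumpShallowCompanionKangarooTowers_of_g29 (h : NoWildFreshJumpShallowCompanionKangarooTowers) :
    NoWildWallFreeFreshJumpShallowCompanionKangarooTowers :=
  noWildFreshJumpShallowCompanionKangarooTowers_iff_g30.mp h

/-- up-link from the TREE aside `NoWildContactFreeOffLocusTowers` (hypothesis-free). [folklore] -/
theorem noWildWallFreeFreshJumpShallowCompanionKangarooTowers_of_aside (h : NoWildContactFreeOffLocusTowers) :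
    NoWildWallFreeFreshJumpShallowCompanionKangarooTowers :=
  noWildWallFreeFreshJumpShallowCompanionKangarooTowers_of_g29 (noWildFreshJumpShallowCompanionKangarooTowers_of_aside h)

end WallCells

end Summit.ResolutionOfSingularities.ResolutionOfSingularities.Theorems.HugValuationCut
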